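import Summits.AtomisticToContinuum.Crystallization.Theorems.FreeSplittingCertificatesRadiusLadderCritical

/-!
# Radius ladder for `FiniteRangeSplitting`: DILATION OF RULES — the rung sets are closed up to `ε`,
# and crux r5 has an ATTAINED critical hard core

Route `FreeSplittingCertificates`, cruxes r2 `FiniteRangeSplitting` (stmt-AtomisticToContinuum-12559) and r5
`ApproxFiniteRangeSplitting` (stmt-12562); block-2b unit `b2b-freesplit`, PART A gen 14.  Value = structural
theorems about the cruxes — NOT summit progress.

`…RadiusLadderCritical` proved that the half-rule threshold `δ_½` is attained by a SCALING argument and remarked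
that the argument is unavailable for pattern-reading rules.  This file shows what survives of it for an ARBITRARY
rule: the rule can be dilated together with the pattern it reads — `scaleRule c Φ (v, T) := Φ (c • v, c • T)` is
again a rule (`isRule_scaleRule`), and reading it at radius `R / c` on `x` is reading `Φ` at radius `R` on `c • x`
bond by bond (`siteE_scaleRule`) — and only the ENERGY fails to scale, at a price controlled by the dilation
estimate `V(c r) − V(r) ≤ (c − 1) r⁻⁶` (`lennardJones_mul_sub_le`, `c ≥ 1`) and the tree's shell sum
`∑_{k ≠ i} r_ik⁻⁶ ≤ 250 δ⁻⁶` (`sum_inv_pow_six_le`):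

* `siteE_smul_sub_le`: `siteE R Φ (c • x) i − 250 (c − 1) δ⁻⁶ ≤ siteE (R/c) (scaleRule c Φ) x i` on
  `δ`-separated `x`; hence `afeasible_scaleRule` / `arungAt_of_arungAt_mul`: an `ε`-rung at hard core `c δ`
  and radius `R` DILATES to an `(ε + 250 (c − 1) δ⁻⁶)`-rung at hard core `δ` and radius `R / c`.
* `mem_aRungSet_of_forall_gt` (**ε-closure**): if every hard core above `δ > 0` carries an `ε`-rung then `δ`
  carries an `(ε + η)`-rung for every `η > 0`; in particular (`critSep_mem_aRungSet`) a positive critical hard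
  core `δ_c = critSep` of crux r2 itself carries `ε`-rungs for EVERY `ε > 0`, and likewise `δ_c(ε)`
  (`critSepApprox_mem_aRungSet`).
* Crux r5 read on the `δ`-axis: `ApproxSet := {δ > 0 | ∀ ε > 0, ∃ R > 0, ARungAt δ ε R}` is an up-set which is
  CLOSED FROM ABOVE (`mem_approxSet_of_forall_gt`), so its infimum `critSepA =: δ_A ∈ [0, δ_c]` is ATTAINED when
  positive (`critSepA_mem`) and `δ ∈ ApproxSet ↔ δ_A ≤ δ` for `δ > 0` (`mem_approxSet_iff_critSepA_le`):
  **`ApproxFiniteRangeSplitting ↔ critSepA = 0`** (`approxFiniteRangeSplitting_iff_critSepA_eq_zero`), and if r5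
  fails it fails EXACTLY on the interval `(0, δ_A)` (`approxSet_eq_Ici`).  Finally `δ_A = sup_{ε > 0} δ_c(ε)`
  (`isLUB_critSepA`).

Exact attainment of `δ_c` (is `RungSet` closed?) remains open: the price `250 (c − 1) δ⁻⁶` of a dilation is
positive for every `c > 1`.
-/

noncomputable section

namespace Summit.AtomisticToContinuum.Crystallization.Theorems.StrictSplittingRuleBirth

open scoped BigOperators Classical
open Literature.MathematicalPhysics.StatisticalMechanics

/-- Euclidean `3`-space. -/
local notation "E3" => EuclideanSpace ℝ (Fin 3)

/-! ## 1. The dilation estimate for the Lennard-Jones potential -/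

/-- `1 − u⁶ ≤ 6 (1 − u)` for `0 ≤ u ≤ 1`. [folklore] -/
theorem one_sub_pow_six_le {u : ℝ} (h0 : 0 ≤ u) (h1 : u ≤ 1) : 1 - u ^ 6 ≤ 6 * (1 - u) := by
  have h2 : u ^ 2 ≤ 1 := pow_le_one₀ h0 h1
  have h3 : u ^ 3 ≤ 1 := pow_le_one₀ h0 h1
  have h4 : u ^ 4 ≤ 1 := pow_le_one₀ h0 h1
  have h5 : u ^ 5 ≤ 1 := pow_le_one₀ h0 h1
  have key : 0 ≤ (1 - u) * (5 - u - u ^ 2 - u ^ 3 - u ^ 4 - u ^ 5) :=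
    mul_nonneg (sub_nonneg.2 h1) (by linarith)
  nlinarith [key]

/-- **Dilation estimate**: `V(c r) − V(r) ≤ (c − 1) r⁻⁶` for `r > 0`, `c ≥ 1` (the repulsive part only decreases
under dilation; the attractive part changes by `(1/6)(1 − c⁻⁶) r⁻⁶ ≤ (1 − c⁻¹) r⁻⁶ ≤ (c − 1) r⁻⁶`). [folklore] -/
theorem lennardJones_mul_sub_le {r c : ℝ} (hr : 0 < r) (hc : 1 ≤ c) :
    lennardJones (c * r) - lennardJones r ≤ (c - 1) * r⁻¹ ^ 6 := by
  have hc0 : 0 < c := by linarith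
  have hu0 : 0 ≤ c⁻¹ := inv_nonneg.2 hc0.le
  have hu1 : c⁻¹ ≤ 1 := inv_le_one_of_one_le₀ hc
  have hs0 : 0 < r⁻¹ := inv_pos.2 hr
  have h6 : 1 - c⁻¹ ^ 6 ≤ 6 * (1 - c⁻¹) := one_sub_pow_six_le hu0 hu1
  have h1u : 1 - c⁻¹ ≤ c - 1 := by
    have h : 1 - c⁻¹ = (c - 1) * c⁻¹ := by field_simp
    rw [h]
    exact mul_le_of_le_one_right (by linarith) hu1
  have hA : c⁻¹ ^ 12 ≤ 1 := pow_le_one₀ hu0 hu1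
  have F1 : 0 ≤ r⁻¹ ^ 12 * (1 - c⁻¹ ^ 12) := mul_nonneg (pow_pos hs0 12).le (sub_nonneg.2 hA)
  have F2 : r⁻¹ ^ 6 * (1 - c⁻¹ ^ 6) ≤ r⁻¹ ^ 6 * (6 * (c - 1)) :=
    mul_le_mul_of_nonneg_left (h6.trans (by linarith)) (pow_pos hs0 6).le
  have hcr : (c * r)⁻¹ = c⁻¹ * r⁻¹ := by rw [mul_inv]
  unfold lennardJones
  rw [hcr, mul_pow, mul_pow]
  nlinarith [F1, F2]

/-- Weighted sums with weights in `[0, 1]` change by at most `250 (c − 1) δ⁻⁶` under dilation of the distances by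
`c ≥ 1`, on a `δ`-separated configuration (`sum_inv_pow_six_le`). [folklore] -/
theorem sum_weight_mul_dilate_le {N : ℕ} {x : Fin N → E3} {δ c : ℝ} (hδ : 0 < δ) (hc : 1 ≤ c) (hx : Sep δ x)
    (i : Fin N) (w : Fin N → ℝ) (hw : ∀ j, 0 ≤ w j ∧ w j ≤ 1) :
    ∑ j ∈ Finset.univ.erase i, w j * lennardJones (c * dist (x i) (x j)) - 250 * (c - 1) * δ⁻¹ ^ 6 ≤
      ∑ j ∈ Finset.univ.erase i, w j * lennardJones (dist (x i) (x j)) := by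
  have hsum := sum_inv_pow_six_le x hδ hx i
  have hterm : ∀ j ∈ Finset.univ.erase i,
      w j * lennardJones (c * dist (x i) (x j)) - (c - 1) * (dist (x i) (x j))⁻¹ ^ 6 ≤
        w j * lennardJones (dist (x i) (x j)) := by
    intro j hj
    have hne : i ≠ j := (Finset.ne_of_mem_erase hj).symm
    have hrpos : 0 < dist (x i) (x j) := hδ.trans_le (hx i j hne)
    have hV := lennardJones_mul_sub_le hrpos hc
    have hB : 0 ≤ (c - 1) * (dist (x i) (x j))⁻¹ ^ 6 :=
      mul_nonneg (by linarith) (pow_nonneg (inv_nonneg.2 dist_nonneg) 6)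
    nlinarith [hw j, mul_le_mul_of_nonneg_left hV (hw j).1]
  have h1 := Finset.sum_le_sum hterm
  rw [Finset.sum_sub_distrib, ← Finset.mul_sum] at h1
  have h2 := mul_le_mul_of_nonneg_left hsum (show 0 ≤ c - 1 by linarith)
  linarith

/-! ## 2. Dilating a rule together with the pattern it reads -/

/-- The rule `Φ` dilated by `c`: `(scaleRule c Φ) v T := Φ (c • v) (c • T)`. [folklore] -/
def scaleRule (c : ℝ) (Φ : E3 → Finset E3 → ℝ) : E3 → Finset E3 → ℝ :=
  fun v T => Φ (c • v) (T.image fun u => c • u)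

/-- A dilated rule is a rule (`c ≠ 0`). -/
theorem isRule_scaleRule {c : ℝ} (hc : c ≠ 0) {Φ : E3 → Finset E3 → ℝ} (hΦ : IsRule Φ) :
    IsRule (scaleRule c Φ) := by
  refine ⟨fun v T => hΦ.1 _ _, fun v T hv => ?_⟩
  have key := hΦ.2 (c • v) (T.image fun u => c • u) (smul_ne_zero hc hv)
  have h2 : (T.image fun u => u - v).image (fun u => c • u) =
      (T.image fun u => c • u).image (fun u => u - c • v) := by
    rw [Finset.image_image, Finset.image_image]
    congr 1
    funext u
    simp [Function.comp, smul_sub]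
  show Φ (c • v) (T.image fun u => c • u) + Φ (c • (-v)) ((T.image fun u => u - v).image fun u => c • u) = 1
  rw [smul_neg, h2]
  exact key

/-- Reading the dilated rule at radius `R / c` on `x` is reading `Φ` at radius `R` on `c • x`, bond by bond
(`c > 0`). -/
theorem scaleRule_apply_pattern {c : ℝ} (hc : 0 < c) (R : ℝ) (Φ : E3 → Finset E3 → ℝ) {N : ℕ}
    (x : Fin N → E3) (i j : Fin N) :
    scaleRule c Φ (x j - x i) ((Finset.univ.filter fun l =>
        dist (x l) (x i) ≤ R / c ∨ dist (x l) (x j) ≤ R / c).image fun l => x l - x i) =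
      Φ (c • x j - c • x i) ((Finset.univ.filter fun l =>
        dist (c • x l) (c • x i) ≤ R ∨ dist (c • x l) (c • x j) ≤ R).image fun l => c • x l - c • x i) := by
  have hfilt : (Finset.univ.filter fun l => dist (x l) (x i) ≤ R / c ∨ dist (x l) (x j) ≤ R / c) =
      (Finset.univ.filter fun l => dist (c • x l) (c • x i) ≤ R ∨ dist (c • x l) (c • x j) ≤ R) := by
    refine Finset.filter_congr fun l _ => ?_
    rw [dist_smul₀, dist_smul₀, Real.norm_of_nonneg hc.le, le_div_iff₀ hc, le_div_iff₀ hc,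
      mul_comm c (dist (x l) (x i)), mul_comm c (dist (x l) (x j))]
  show Φ (c • (x j - x i)) (((Finset.univ.filter fun l =>
        dist (x l) (x i) ≤ R / c ∨ dist (x l) (x j) ≤ R / c).image fun l => x l - x i).image fun u => c • u) = _
  rw [smul_sub, Finset.image_image, hfilt]
  congr 1
  refine Finset.image_congr fun l _ => ?_
  simp [Function.comp, smul_sub]

/-- The weighted site energy of the dilated rule at radius `R / c` on `x`, written with the weights `Φ` assigns
in `c • x` at radius `R`. -/
theorem siteE_scaleRule {c : ℝ} (hc : 0 < c) (R : ℝ) (Φ : E3 → Finset E3 → ℝ) {N : ℕ}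
    (x : Fin N → E3) (i : Fin N) :
    siteE (R / c) (scaleRule c Φ) x i =
      ∑ j ∈ Finset.univ.erase i, Φ (c • x j - c • x i) ((Finset.univ.filter fun l =>
        dist (c • x l) (c • x i) ≤ R ∨ dist (c • x l) (c • x j) ≤ R).image fun l => c • x l - c • x i) *
        lennardJones (dist (x i) (x j)) := by
  unfold siteE
  refine Finset.sum_congr rfl fun j _ => ?_
  rw [scaleRule_apply_pattern hc]

/-- **Dilation transfer of site energies.**  For a rule `Φ`, a `δ`-separated `x` (`δ > 0`) and `c ≥ 1`:
`siteE R Φ (c • x) i − 250 (c − 1) δ⁻⁶ ≤ siteE (R / c) (scaleRule c Φ) x i`. -/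
theorem siteE_smul_sub_le {δ c R : ℝ} (hδ : 0 < δ) (hc : 1 ≤ c) {Φ : E3 → Finset E3 → ℝ} (hΦ : IsRule Φ)
    {N : ℕ} {x : Fin N → E3} (hx : Sep δ x) (i : Fin N) :
    siteE R Φ (fun k => c • x k) i - 250 * (c - 1) * δ⁻¹ ^ 6 ≤ siteE (R / c) (scaleRule c Φ) x i := by
  have hc0 : 0 < c := by linarith
  rw [siteE_scaleRule hc0]
  have hdist : ∀ j, dist (c • x i) (c • x j) = c * dist (x i) (x j) := fun j => by
    rw [dist_smul₀, Real.norm_of_nonneg hc0.le]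
  have hL : siteE R Φ (fun k => c • x k) i = ∑ j ∈ Finset.univ.erase i,
      Φ (c • x j - c • x i) ((Finset.univ.filter fun l =>
        dist (c • x l) (c • x i) ≤ R ∨ dist (c • x l) (c • x j) ≤ R).image fun l => c • x l - c • x i) *
        lennardJones (c * dist (x i) (x j)) := by
    unfold siteE
    refine Finset.sum_congr rfl fun j _ => ?_
    rw [hdist]
  rw [hL]
  exact sum_weight_mul_dilate_le hδ hc hx i (fun j => Φ (c • x j - c • x i) ((Finset.univ.filter fun l =>
    dist (c • x l) (c • x i) ≤ R ∨ dist (c • x l) (c • x j) ≤ R).image fun l => c • x l - c • x i))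
    (fun j => hΦ.1 _ _)

/-- **Dilation of an `ε`-feasible rule**: `AFeasible (c δ) ε R Φ → AFeasible δ (ε + 250 (c − 1) δ⁻⁶) (R / c)
(scaleRule c Φ)` for `δ > 0`, `c ≥ 1`. -/
theorem afeasible_scaleRule {δ ε c R : ℝ} (hδ : 0 < δ) (hc : 1 ≤ c) {Φ : E3 → Finset E3 → ℝ}
    (hΦ : IsRule Φ) (hf : AFeasible (c * δ) ε R Φ) :
    AFeasible δ (ε + 250 * (c - 1) * δ⁻¹ ^ 6) (R / c) (scaleRule c Φ) := by
  intro N x hx i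
  have h1 := hf N _ (sep_smul_of_nonneg (by linarith : (0 : ℝ) ≤ c) hx) i
  have h2 := siteE_smul_sub_le (R := R) hδ hc hΦ hx i
  linarith

/-- **Dilation of an `ε`-rung**: `ARungAt (c δ) ε R → ARungAt δ (ε + 250 (c − 1) δ⁻⁶) (R / c)`. -/
theorem arungAt_of_arungAt_mul {δ ε c R : ℝ} (hδ : 0 < δ) (hc : 1 ≤ c) (h : ARungAt (c * δ) ε R) :
    ARungAt δ (ε + 250 * (c - 1) * δ⁻¹ ^ 6) (R / c) := by
  obtain ⟨Φ, hΦ, hf⟩ := h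
  have hc0 : (0 : ℝ) < c := by linarith
  exact ⟨scaleRule c Φ, isRule_scaleRule hc0.ne' hΦ, afeasible_scaleRule hδ hc hΦ hf⟩

/-- The same for exact rungs: `RungAt (c δ) R → ARungAt δ (250 (c − 1) δ⁻⁶) (R / c)`. -/
theorem arungAt_of_rungAt_mul {δ c R : ℝ} (hδ : 0 < δ) (hc : 1 ≤ c) (h : RungAt (c * δ) R) :
    ARungAt δ (250 * (c - 1) * δ⁻¹ ^ 6) (R / c) := by
  have := arungAt_of_arungAt_mul hδ hc ((arungAt_zero_iff (c * δ) R).2 h)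
  simpa using this

/-! ## 3. The rung sets are closed up to `ε` -/

/-- **ε-closure.**  If every hard core above `δ > 0` carries an `ε`-rung, then `δ` carries an `(ε + η)`-rung for
every `η > 0` (dilate by `c = 1 + η δ⁶ / 250`). -/
theorem mem_aRungSet_of_forall_gt {δ ε η : ℝ} (hδ : 0 < δ) (hη : 0 < η)
    (h : ∀ δ' : ℝ, δ < δ' → δ' ∈ ARungSet ε) : δ ∈ ARungSet (ε + η) := by
  set c : ℝ := 1 + η * δ ^ 6 / 250 with hc_def
  have hpos : 0 < η * δ ^ 6 / 250 := by positivity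
  have hc1 : 1 < c := by rw [hc_def]; linarith
  obtain ⟨-, R, hR, hrung⟩ := h (c * δ) (lt_mul_of_one_lt_left hδ hc1)
  refine ⟨hδ, R / c, div_pos hR (by linarith), ?_⟩
  have key := arungAt_of_arungAt_mul hδ hc1.le hrung
  have heq : ε + 250 * (c - 1) * δ⁻¹ ^ 6 = ε + η := by
    have hc' : c - 1 = η * δ ^ 6 / 250 := by rw [hc_def]; ring
    rw [hc', inv_pow]
    field_simp
  rw [heq] at key
  exact key

/-- From exact rungs above `δ` to `ε`-rungs at `δ`, for every `ε > 0`. -/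
theorem mem_aRungSet_of_forall_gt_mem_rungSet {δ ε : ℝ} (hδ : 0 < δ) (hε : 0 < ε)
    (h : ∀ δ' : ℝ, δ < δ' → δ' ∈ RungSet) : δ ∈ ARungSet ε := by
  have := mem_aRungSet_of_forall_gt (ε := 0) hδ hε fun δ' hδ' => rungSet_subset_aRungSet le_rfl (h δ' hδ')
  simpa using this

/-- **A positive critical hard core of crux r2 carries `ε`-rungs for every `ε > 0`.** -/
theorem critSep_mem_aRungSet (hpos : 0 < critSep) {ε : ℝ} (hε : 0 < ε) : critSep ∈ ARungSet ε :=
  mem_aRungSet_of_forall_gt_mem_rungSet hpos hε fun _ h => mem_rungSet_of_critSep_lt h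

/-- Likewise `δ_c(ε)`, if positive, carries `(ε + η)`-rungs for every `η > 0`. -/
theorem critSepApprox_mem_aRungSet {ε η : ℝ} (hε : 0 ≤ ε) (hpos : 0 < critSepApprox ε) (hη : 0 < η) :
    critSepApprox ε ∈ ARungSet (ε + η) :=
  mem_aRungSet_of_forall_gt hpos hη fun _ h => mem_aRungSet_of_critSepApprox_lt hε h

/-! ## 4. Crux r5 on the `δ`-axis: an attained critical hard core -/

/-- The hard cores at which crux r5's conclusion holds: `ε`-rungs exist for every `ε > 0`. [folklore] -/
def ApproxSet : Set ℝ := {δ : ℝ | 0 < δ ∧ ∀ ε : ℝ, 0 < ε → ∃ R : ℝ, 0 < R ∧ ARungAt δ ε R}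

/-- Membership in `ApproxSet` is membership in every `ARungSet ε`, `ε > 0`. -/
theorem mem_approxSet_iff {δ : ℝ} : δ ∈ ApproxSet ↔ 0 < δ ∧ ∀ ε : ℝ, 0 < ε → δ ∈ ARungSet ε := by
  simp only [ApproxSet, ARungSet, Set.mem_setOf_eq]
  constructor
  · exact fun h => ⟨h.1, fun ε hε => ⟨h.1, h.2 ε hε⟩⟩
  · exact fun h => ⟨h.1, fun ε hε => (h.2 ε hε).2⟩

/-- Crux r5 says: every positive hard core lies in `ApproxSet`. -/
theorem approxFiniteRangeSplitting_iff_approxSet :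
    Summit.AtomisticToContinuum.Crystallization.Theses.FreeSplittingCertificates.ApproxFiniteRangeSplitting ↔
      ∀ δ : ℝ, 0 < δ → δ ∈ ApproxSet := by
  rw [approxFiniteRangeSplitting_iff_arung]
  exact ⟨fun h δ hδ => ⟨hδ, h δ hδ⟩, fun h δ hδ => (h δ hδ).2⟩

/-- `ApproxSet` is an up-set. -/
theorem mem_approxSet_of_le {δ δ' : ℝ} (h : δ ∈ ApproxSet) (hle : δ ≤ δ') : δ' ∈ ApproxSet :=
  ⟨h.1.trans_le hle, fun ε hε => (h.2 ε hε).imp fun _ hR => ⟨hR.1, arungAt_mono_sep hle hR.2⟩⟩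

/-- `RungSet ⊆ ApproxSet`. -/
theorem rungSet_subset_approxSet : RungSet ⊆ ApproxSet :=
  fun _ hδ => ⟨hδ.1, fun _ hε => hδ.2.imp fun _ hR => ⟨hR.1, arungAt_of_rungAt hε.le hR.2⟩⟩

/-- `ApproxSet ⊆ ARungSet ε` for `ε > 0`. -/
theorem approxSet_subset_aRungSet {ε : ℝ} (hε : 0 < ε) : ApproxSet ⊆ ARungSet ε :=
  fun _ h => (mem_approxSet_iff.1 h).2 ε hε

/-- `ApproxSet` is nonempty. -/
theorem approxSet_nonempty : ApproxSet.Nonempty :=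
  rungSet_nonempty.mono rungSet_subset_approxSet

/-- `ApproxSet` is bounded below by `0`. -/
theorem approxSet_bddBelow : BddBelow ApproxSet :=
  ⟨0, fun _ h => h.1.le⟩

/-- **`ApproxSet` is closed from above**: if every hard core above `δ > 0` is in it, so is `δ`. -/
theorem mem_approxSet_of_forall_gt {δ : ℝ} (hδ : 0 < δ) (h : ∀ δ' : ℝ, δ < δ' → δ' ∈ ApproxSet) :
    δ ∈ ApproxSet := by
  refine mem_approxSet_iff.2 ⟨hδ, fun ε hε => ?_⟩
  have := mem_aRungSet_of_forall_gt (ε := ε / 2) (η := ε / 2) hδ (by positivity)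
    fun δ' hδ' => approxSet_subset_aRungSet (by positivity) (h δ' hδ')
  rwa [add_halves] at this

/-- The critical hard core of crux r5: `δ_A := inf ApproxSet`. [folklore] -/
def critSepA : ℝ := sInf ApproxSet

/-- `0 ≤ δ_A`. -/
theorem critSepA_nonneg : 0 ≤ critSepA :=
  le_csInf approxSet_nonempty fun _ h => h.1.le

/-- `δ_A ≤ δ` for every `δ ∈ ApproxSet`. -/
theorem critSepA_le_of_mem {δ : ℝ} (h : δ ∈ ApproxSet) : critSepA ≤ δ :=
  csInf_le approxSet_bddBelow h

/-- `δ_A ≤ δ_c`. -/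
theorem critSepA_le_critSep : critSepA ≤ critSep :=
  csInf_le_csInf approxSet_bddBelow rungSet_nonempty rungSet_subset_approxSet

/-- `δ_c(ε) ≤ δ_A` for every `ε > 0`. -/
theorem critSepApprox_le_critSepA {ε : ℝ} (hε : 0 < ε) : critSepApprox ε ≤ critSepA :=
  csInf_le_csInf (aRungSet_bddBelow ε) approxSet_nonempty (approxSet_subset_aRungSet hε)

/-- Every hard core strictly above `δ_A` is in `ApproxSet`. -/
theorem mem_approxSet_of_critSepA_lt {δ : ℝ} (h : critSepA < δ) : δ ∈ ApproxSet := by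
  obtain ⟨s, hs, hsδ⟩ := (csInf_lt_iff approxSet_bddBelow approxSet_nonempty).mp h
  exact mem_approxSet_of_le hs hsδ.le

/-- **Attainment**: a positive `δ_A` lies in `ApproxSet` — at the critical hard core of crux r5 itself there are
`ε`-rungs for every `ε > 0`. -/
theorem critSepA_mem (hpos : 0 < critSepA) : critSepA ∈ ApproxSet :=
  mem_approxSet_of_forall_gt hpos fun _ h => mem_approxSet_of_critSepA_lt h

/-- **The truth set of crux r5's conclusion is a closed ray**: for `δ > 0`, `δ ∈ ApproxSet ↔ δ_A ≤ δ`. -/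
theorem mem_approxSet_iff_critSepA_le {δ : ℝ} (hδ : 0 < δ) : δ ∈ ApproxSet ↔ critSepA ≤ δ := by
  refine ⟨critSepA_le_of_mem, fun h => ?_⟩
  rcases h.lt_or_eq with hlt | heq
  · exact mem_approxSet_of_critSepA_lt hlt
  · rw [← heq]
    exact critSepA_mem (heq ▸ hδ)

/-- No positive hard core strictly below `δ_A` carries `ε`-rungs for all `ε > 0`. -/
theorem not_mem_approxSet_of_lt_critSepA {δ : ℝ} (h : δ < critSepA) : δ ∉ ApproxSet :=
  fun hm => absurd (critSepA_le_of_mem hm) (not_le.mpr h)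

/-- **Crux r5 is the vanishing of ONE number**: `ApproxFiniteRangeSplitting ↔ δ_A = 0`. -/
theorem approxFiniteRangeSplitting_iff_critSepA_eq_zero :
    Summit.AtomisticToContinuum.Crystallization.Theses.FreeSplittingCertificates.ApproxFiniteRangeSplitting ↔
      critSepA = 0 := by
  rw [approxFiniteRangeSplitting_iff_approxSet]
  constructor
  · intro h
    refine le_antisymm (le_of_forall_gt_imp_ge_of_dense fun δ hδ => ?_) critSepA_nonneg
    exact critSepA_le_of_mem (h δ hδ)
  · intro h δ hδ
    exact mem_approxSet_of_critSepA_lt (h ▸ hδ)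

/-- Negative form: `¬ ApproxFiniteRangeSplitting ↔ 0 < δ_A`. -/
theorem not_approxFiniteRangeSplitting_iff_critSepA_pos :
    ¬ Summit.AtomisticToContinuum.Crystallization.Theses.FreeSplittingCertificates.ApproxFiniteRangeSplitting ↔
      0 < critSepA := by
  rw [approxFiniteRangeSplitting_iff_critSepA_eq_zero]
  exact ⟨fun h => lt_of_le_of_ne critSepA_nonneg (Ne.symm h), fun h => h.ne'⟩

/-- **If crux r5 fails, it fails exactly on `(0, δ_A)`**: `ApproxSet = [δ_A, ∞)` when `δ_A > 0`. -/
theorem approxSet_eq_Ici (hpos : 0 < critSepA) : ApproxSet = Set.Ici critSepA := by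
  ext δ
  refine ⟨fun h => critSepA_le_of_mem h, fun h => ?_⟩
  exact (mem_approxSet_iff_critSepA_le (hpos.trans_le h)).2 h

/-- And if it holds, `ApproxSet = (0, ∞)`. -/
theorem approxSet_eq_Ioi (h0 : critSepA = 0) : ApproxSet = Set.Ioi 0 := by
  ext δ
  refine ⟨fun h => h.1, fun h => mem_approxSet_of_critSepA_lt ?_⟩
  rw [h0]
  exact h

/-- `δ_A` is the least upper bound of the `δ_c(ε)`, `ε > 0`: `δ_A = sup_{ε > 0} δ_c(ε)`. -/
theorem isLUB_critSepA : IsLUB ((fun ε : ℝ => critSepApprox ε) '' Set.Ioi 0) critSepA := by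
  refine ⟨?_, fun b hb => ?_⟩
  · rintro _ ⟨ε, hε, rfl⟩
    exact critSepApprox_le_critSepA hε
  · refine le_of_forall_gt_imp_ge_of_dense fun δ hδ => critSepA_le_of_mem ?_
    have hδpos : 0 < δ := by
      have h1 : critSepApprox 1 ≤ b := hb ⟨1, by norm_num, rfl⟩
      linarith [critSepApprox_nonneg (zero_le_one : (0 : ℝ) ≤ 1)]
    refine mem_approxSet_iff.2 ⟨hδpos, fun ε hε => mem_aRungSet_of_critSepApprox_lt hε.le ?_⟩
    exact (hb ⟨ε, hε, rfl⟩).trans_lt hδ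

/-- Summary of the two critical hard cores: `0 ≤ δ_A ≤ δ_c ≤ δ_½`, crux r2 `↔ δ_c = 0`, crux r5 `↔ δ_A = 0`,
and a positive `δ_c` is an accumulation point of rungs from above that itself carries `ε`-rungs for all
`ε > 0`. -/
theorem critical_hard_cores :
    0 ≤ critSepA ∧ critSepA ≤ critSep ∧ critSep ≤ halfSumThreshold ∧
    (Summit.AtomisticToContinuum.Crystallization.Theses.FreeSplittingCertificates.FiniteRangeSplitting ↔
      critSep = 0) ∧
    (Summit.AtomisticToContinuum.Crystallization.Theses.FreeSplittingCertificates.ApproxFiniteRangeSplitting ↔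
      critSepA = 0) ∧
    (0 < critSep → ∀ ε : ℝ, 0 < ε → critSep ∈ ARungSet ε) :=
  ⟨critSepA_nonneg, critSepA_le_critSep, critSep_le_halfSumThreshold, finiteRangeSplitting_iff_critSep_eq_zero,
    approxFiniteRangeSplitting_iff_critSepA_eq_zero, fun h _ hε => critSep_mem_aRungSet h hε⟩

end Summit.AtomisticToContinuum.Crystallization.Theorems.StrictSplittingRuleBirth

end
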